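import Summits.QuantumFields.QCD.Theorems.PauliWegnerSeaFMClosureUnquenchedClosureC1Aux6
import Literature.MathematicalPhysics.QuantumLattice.SubharmonicIterationDecay

/-!
# Crux `FMClosureUnquenched` (stmt-QuantumFields-11512), line `von-mises-circles`, stub `stub_closure`:
helper 7 — the collar bound at one volume (iteration of the one-step subharmonicity)

In the fit case `3ℓ₀ + 4 ≤ S`: the exit moment is small (`c1_exit_small`), hence the one-step subharmonicity
`c1_subharmonic_le` holds with a ratio `b ≤ 𝕂²³ Θ^{23𝕔} Θ^{-θκ}`; if this is `≤ 1` the iteration lemma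
`SubharmonicIteration.le_mul_pow_div_of_sum_step` (torus sup-distance, neighbourhoods
`y - (boxIn(3ℓ₀+2) ∪ boxOut(3ℓ₀+2))`, a-priori bound (T5)) gives `E(0, v) ≤ M b^{⌊‖v‖_∞/(3ℓ₀+4)⌋}` with
`M ≤ 𝕂 Θ^𝕔` (`c1_collar_bound`).

References: Aizenman–Schenker–Friedrich–Hundertmark, CMP 224 (2001) 219, proof of Thm 2 [AizenmanEtAl2001].
-/

noncomputable section

open scoped BigOperators
open MeasureTheory Filter
open Literature.MathematicalPhysics.QuantumFieldTheory Literature.MathematicalPhysics.QuantumLattice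
  Literature.Probability.LatticeModels
open Summit.QuantumFields.QCD.Theorems.VonMisesCircles

namespace Summit.QuantumFields.QCD.Theorems.VonMisesCirclesC1

/-- Choice of the decay parameter: some natural `q` has `q · r ≥ T` (`r > 0`). [folklore] -/
theorem c1_exists_nat_mul_ge (r T : ℝ) (hr : 0 < r) : ∃ q : ℕ, T ≤ (q : ℝ) * r := by
  obtain ⟨q, hq⟩ := exists_nat_ge (T / r)
  exact ⟨q, by rwa [div_le_iff₀ hr] at hq⟩

/-- **Registered helper `c1_rpow_neg_log_div` of crux stmt-QuantumFields-11512** (line `von-mises-circles`, stub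
`stub_closure`): `Θ^{-(log A / log Θ)} = A⁻¹` for `Θ > 1`, `A > 0` (the smallness `Θ^{c - θκ} ≤ A⁻¹` behind the choice
of `q`). [folklore] -/
theorem c1_rpow_neg_log_div : ∀ (Θ A : ℝ), 1 < Θ → 0 < A → Θ ^ (-(Real.log A / Real.log Θ)) = A⁻¹ := by
  intro Θ A hΘ hA
  have hlog : Real.log Θ ≠ 0 := (Real.log_pos hΘ).ne'
  rw [Real.rpow_def_of_pos (by linarith), show Real.log Θ * -(Real.log A / Real.log Θ) = -Real.log A by
    rw [mul_neg, mul_div_cancel₀ _ hlog], Real.exp_neg, Real.exp_log hA]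

section Volume

variable {Nf S : ℕ} {β t s₀ C p Cf pf θ cT 𝕂 𝕔 : ℝ} {mq : Fin Nf → ℝ} {f : Fin Nf}

variable (ht0 : 0 < t) (ht1 : t ≤ 1) (hts : t ≤ s₀) (hcT : 0 < cT) (hC : 0 < C) (hCf : 0 < Cf)
  (hθ0 : 0 < θ) (hθ1 : θ ≤ 1)
  (h𝕂 : 𝕂 = max (max 2 (cT ^ 2)) (max (max (C * 6 ^ (max p 0)) (Cf * 6 ^ (max pf 0))) ((14 : ℝ) ^ 4)))
  (h𝕔 : 𝕔 = 2 * max p 0 + 2 * max pf 0 + 4)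
  (hT0 : ∀ (s₁ s₂ s₃ : ℝ), 0 ≤ s₁ → s₁ ≤ s₀ → 0 ≤ s₂ → s₂ ≤ s₀ → 0 ≤ s₃ → s₃ ≤ s₀ →
      ∀ (A₁ A₂ A₃ : Finset (TorusSite 4 (2 * S + 1))),
        AdmissibleSide S A₁ → AdmissibleSide S A₂ → AdmissibleSide S A₃ →
      ∀ (a₁ b₁ a₂ b₂ a₃ b₃ : TorusSite 4 (2 * S + 1)),
      Integrable (fun U : GaugeConfig 4 (2 * S + 1) (Matrix.specialUnitaryGroup (Fin 3) ℂ) =>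
        ‖(diracMatrix U mq).det‖ *
          (blockNorm (gside A₁ (wilsonD U (mq f))) a₁ b₁ ^ s₁ *
            blockNorm (gside A₂ (wilsonD U (mq f))) a₂ b₂ ^ s₂ *
            blockNorm (gside A₃ (wilsonD U (mq f))) a₃ b₃ ^ s₃))
        (wilsonMeasure (fundamentalRep (Fin 3)) β))
  (hTinv : ∀ (A : Finset (TorusSite 4 (2 * S + 1))), AdmissibleSide S A →
      ∀ᵐ U ∂(wilsonMeasure (d := 4) (L := 2 * S + 1) (fundamentalRep (Fin 3)) β),
        (sideMatrix A (wilsonD U (mq f))).det ≠ 0)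
  (hT5 : ∀ x y : TorusSite 4 (2 * S + 1),
      pqE Nf S β mq (fun U => blockNorm (wilsonD U (mq f))⁻¹ x y ^ t) ≤ C * (1 + |β|) ^ p)
  (hTdec : ∀ (x : TorusSite 4 (2 * S + 1)) (r : ℕ), 1 ≤ r → r + 1 ≤ S →
      ∀ (A : Finset (TorusSite 4 (2 * S + 1))),
        (A = ebox S x r ∨ A = (ebox S x r)ᶜ ∨ A = (ball S x r)ᶜ) →
      ∀ a b c d : TorusSite 4 (2 * S + 1), a ∈ A → b ∈ A →
        pqE Nf S β mq (fun U =>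
            blockNorm (gside A (wilsonD U (mq f))) a b ^ t * blockNorm (wilsonD U (mq f))⁻¹ c d ^ t) ≤
          C * (1 + |β|) ^ p * (1 + (r : ℝ)) ^ p *
            pqE Nf S β mq (fun U => blockNorm (wilsonD U (mq f))⁻¹ c d ^ t))
  (hT1 : ∀ (x : TorusSite 4 (2 * S + 1)) (ℓ : ℕ), 1 ≤ ℓ → 3 * ℓ + 4 ≤ S →
      ∀ u u' v v' y : TorusSite 4 (2 * S + 1),
        u' ∈ ebox S x (3 * ℓ + 2) → u' ∉ ebox S x ℓ → v ∈ ebox S x (3 * ℓ + 2) → v ∉ ebox S x ℓ →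
        v' ∉ ebox S x (3 * ℓ + 2) → y ∉ ebox S x (3 * ℓ + 2) →
          pqE Nf S β mq (fun U =>
              blockNorm (gside (ebox S x ℓ) (wilsonD U (mq f))) x u ^ t *
                blockNorm (wilsonD U (mq f))⁻¹ u' v ^ t *
                blockNorm (gside (ebox S x (3 * ℓ + 2))ᶜ (wilsonD U (mq f))) v' y ^ t) ≤
            C * (1 + |β|) ^ p * (1 + (ℓ : ℝ)) ^ p *
              pqE Nf S β mq (fun U =>
                blockNorm (gside (ebox S x ℓ) (wilsonD U (mq f))) x u ^ t *
                  blockNorm (gside (ebox S x (3 * ℓ + 2))ᶜ (wilsonD U (mq f))) v' y ^ t))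
  (hFar : ∀ (x : TorusSite 4 (2 * S + 1)) (ℓ : ℕ), 1 ≤ ℓ → 3 * ℓ + 4 ≤ S →
      ∀ u v' y : TorusSite 4 (2 * S + 1),
        u ∈ ebox S x ℓ → v' ∉ ebox S x (3 * ℓ + 2) → y ∉ ebox S x (3 * ℓ + 2) →
        pqE Nf S β mq (fun U =>
            blockNorm (gside (ebox S x ℓ) (wilsonD U (mq f))) x u ^ t *
              blockNorm (gside (ebox S x (3 * ℓ + 2))ᶜ (wilsonD U (mq f))) v' y ^ t) ≤
          Cf * (1 + |β|) ^ pf * (1 + (ℓ : ℝ)) ^ pf *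
            (pqE Nf S β mq (fun U => blockNorm (gside (ebox S x ℓ) (wilsonD U (mq f))) x u ^ t) ^ θ +
              pqE Nf S β mq (fun U => blockNorm (gside (ebox S x ℓ) (wilsonD U (mq f))) x u ^ t)) *
            pqE Nf S β mq (fun U =>
              blockNorm (gside (ebox S x (3 * ℓ + 2))ᶜ (wilsonD U (mq f))) v' y ^ t))
  (hR : ∀ (U : GaugeConfig 4 (2 * S + 1) (Matrix.specialUnitaryGroup (Fin 3) ℂ))
      (x : TorusSite 4 (2 * S + 1)),
      (∀ r : ℕ, 1 ≤ r → r + 1 ≤ S → ∀ z : TorusSite 4 (2 * S + 1), z ∉ ball S x r →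
        (sideMatrix (ball S x r)ᶜ (wilsonD U (mq f))).det ≠ 0 →
          blockNorm (wilsonD U (mq f))⁻¹ x z ≤
            cT * ∑ p ∈ sphere S x r, ∑ p' ∈ sphere S x (r + 1),
              blockNorm (wilsonD U (mq f))⁻¹ x p * blockNorm (gside (ball S x r)ᶜ (wilsonD U (mq f))) p' z) ∧
      ∀ ℓ : ℕ, 1 ≤ ℓ → ℓ + 2 ≤ S →
        (∀ u : TorusSite 4 (2 * S + 1), u ∈ ebox S x ℓ → (wilsonD U (mq f)).det ≠ 0 →
          blockNorm (gside (ebox S x ℓ) (wilsonD U (mq f))) x u ≤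
            blockNorm (wilsonD U (mq f))⁻¹ x u +
              cT * ∑ w' ∈ boxOut S x ℓ, ∑ w ∈ boxIn S x ℓ,
                blockNorm (wilsonD U (mq f))⁻¹ x w' * blockNorm (gside (ebox S x ℓ) (wilsonD U (mq f))) w u) ∧
        (3 * ℓ + 4 ≤ S →
          (∀ v' y : TorusSite 4 (2 * S + 1), v' ∉ ebox S x (3 * ℓ + 2) → y ∉ ebox S x (3 * ℓ + 2) →
            (wilsonD U (mq f)).det ≠ 0 →
              blockNorm (gside (ebox S x (3 * ℓ + 2))ᶜ (wilsonD U (mq f))) v' y ≤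
                blockNorm (wilsonD U (mq f))⁻¹ v' y +
                  cT * ∑ w' ∈ boxOut S x (3 * ℓ + 2), ∑ w ∈ boxIn S x (3 * ℓ + 2),
                    blockNorm (gside (ebox S x (3 * ℓ + 2))ᶜ (wilsonD U (mq f))) v' w' *
                      blockNorm (wilsonD U (mq f))⁻¹ w y) ∧
          (∀ y : TorusSite 4 (2 * S + 1), y ∉ ebox S x (3 * ℓ + 2) →
            (sideMatrix (ebox S x ℓ) (wilsonD U (mq f))).det ≠ 0 →
            (sideMatrix (ebox S x (3 * ℓ + 2))ᶜ (wilsonD U (mq f))).det ≠ 0 →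
              blockNorm (wilsonD U (mq f))⁻¹ x y ≤
                cT ^ 2 * ∑ u ∈ boxIn S x ℓ, ∑ u' ∈ boxOut S x ℓ,
                  ∑ v ∈ boxIn S x (3 * ℓ + 2), ∑ v' ∈ boxOut S x (3 * ℓ + 2),
                    blockNorm (gside (ebox S x ℓ) (wilsonD U (mq f))) x u * blockNorm (wilsonD U (mq f))⁻¹ u' v *
                      blockNorm (gside (ebox S x (3 * ℓ + 2))ᶜ (wilsonD U (mq f))) v' y)))
  {ℓ₀ : ℕ} (hℓ1 : 1 ≤ ℓ₀) (hℓS : ℓ₀ ≤ S) {Θk κ : ℝ} (hΘk : Θk = (ℓ₀ : ℝ) * (1 + |β|)) (hκ : 0 ≤ κ)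
  (hshell : ∀ w : Site 4, w ∈ box 4 S → ‖w‖ = (ℓ₀ : ℝ) →
    pqE Nf S β mq (fun U => blockNorm (wilsonD U (mq f))⁻¹ 0 (Torus.proj (2 * S + 1) w) ^ t) ≤ Θk ^ (-κ))

include ht0 ht1 hts hcT hC hCf hθ0 hθ1 h𝕂 h𝕔 hT0 hTinv hT5 hTdec hT1 hFar hR hℓ1 hℓS hΘk hκ hshell

/-- **The collar bound** (fit case `3ℓ₀ + 4 ≤ S`, small ratio): `E(0, v) ≤ M b^{⌊‖v‖_∞/(3ℓ₀+4)⌋}` for every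
`v ∈ box S`, with `0 ≤ b ≤ 𝕂²³ Θ^{23𝕔} Θ^{-θκ}` and `0 ≤ M ≤ 𝕂 Θ^𝕔`.
[cite: AizenmanEtAl2001, proof of Thm 2] -/
theorem c1_collar_bound (hfit : 3 * ℓ₀ + 4 ≤ S)
    (hsmall : 𝕂 ^ 23 * Θk ^ (((23 : ℕ) : ℝ) * 𝕔) * Θk ^ (-(θ * κ)) ≤ 1) (v : Site 4) (hv : v ∈ box 4 S) :
    ∃ b M : ℝ, 0 ≤ b ∧ b ≤ 𝕂 ^ 23 * Θk ^ (((23 : ℕ) : ℝ) * 𝕔) * Θk ^ (-(θ * κ)) ∧ 0 ≤ M ∧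
      M ≤ 𝕂 ^ 1 * Θk ^ (((1 : ℕ) : ℝ) * 𝕔) ∧
      pqE Nf S β mq (fun U => blockNorm (wilsonD U (mq f))⁻¹ 0 (Torus.proj (2 * S + 1) v) ^ t) ≤
        M * b ^ (Site.supNorm v / (3 * ℓ₀ + 4)) := by
  obtain ⟨hΘ1, hℓΘ, hβΘ⟩ := c1_Theta_facts hℓ1 hΘk
  have hΘ0 : 0 < Θk := by linarith
  have hK2 := c1_two_le_K h𝕂
  have hK1 : 1 ≤ 𝕂 := by linarith
  have hc0 := c1_c_nonneg (p := p) (pf := pf) h𝕔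
  have hℓS2 : ℓ₀ + 2 ≤ S := by omega
  have h33 : 3 * ℓ₀ + 3 ≤ S := by omega
  have hrS2 : 3 * ℓ₀ + 2 + 2 ≤ S := by omega
  -- the exit moment and `α`
  set P : ℝ := 𝕂 ^ 9 * Θk ^ (((9 : ℕ) : ℝ) * 𝕔) with hP
  have hP1 : 1 ≤ P := by
    rw [hP, ← one_mul (1 : ℝ)]
    exact mul_le_mul (one_le_pow₀ hK1) (Real.one_le_rpow hΘ1 (by positivity)) zero_le_one (by positivity)
  have hD0 : 0 ≤ Θk ^ (-κ) := Real.rpow_nonneg hΘ0.le _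
  have hDθ0 : 0 ≤ Θk ^ (-(θ * κ)) := Real.rpow_nonneg hΘ0.le _
  set α : ℝ := (P * Θk ^ (-κ)) ^ θ + P * Θk ^ (-κ) with hα
  have hε0 : 0 ≤ P * Θk ^ (-κ) := by positivity
  have hα0 : 0 ≤ α := add_nonneg (Real.rpow_nonneg hε0 _) hε0
  have hA : ∀ u ∈ boxIn S 0 ℓ₀,
      pqE Nf S β mq (fun U => blockNorm (gside (ebox S 0 ℓ₀) (wilsonD U (mq f))) 0 u ^ t) ^ θ +
        pqE Nf S β mq (fun U => blockNorm (gside (ebox S 0 ℓ₀) (wilsonD U (mq f))) 0 u ^ t) ≤ α := by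
    intro u hu
    have h := c1_exit_small ht0 ht1 hts hcT hC h𝕂 h𝕔 hT0 hTinv hTdec hR hℓ1 hℓS hΘk hshell hfit u hu
    have h0 : 0 ≤ pqE Nf S β mq (fun U => blockNorm (gside (ebox S 0 ℓ₀) (wilsonD U (mq f))) 0 u ^ t) :=
      pqE_nonneg β mq _ fun U => Real.rpow_nonneg (blockNorm_nonneg _ _ _) _
    exact add_le_add (Real.rpow_le_rpow h0 h hθ0.le) h
  -- `α ≤ 𝕂¹⁰ Θ^{10𝕔} Θ^{-θκ}`
  have hDD : Θk ^ (-κ) ≤ Θk ^ (-(θ * κ)) :=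
    Real.rpow_le_rpow_of_exponent_le hΘ1 (by nlinarith)
  have hαle : α ≤ 𝕂 ^ 10 * Θk ^ (((10 : ℕ) : ℝ) * 𝕔) * Θk ^ (-(θ * κ)) := by
    have h1 : (P * Θk ^ (-κ)) ^ θ ≤ P * Θk ^ (-(θ * κ)) := by
      rw [Real.mul_rpow (by linarith) hD0, ← Real.rpow_mul hΘ0.le]
      refine mul_le_mul ((Real.rpow_le_rpow_of_exponent_le hP1 hθ1).trans_eq (Real.rpow_one P)) (le_of_eq ?_)
        (Real.rpow_nonneg hΘ0.le _) (by linarith)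
      ring_nf
    have h2 : P * Θk ^ (-κ) ≤ P * Θk ^ (-(θ * κ)) := mul_le_mul_of_nonneg_left hDD (by linarith)
    have h3 : P + P ≤ 𝕂 ^ 10 * Θk ^ (((10 : ℕ) : ℝ) * 𝕔) := c1_mono_add (n := 10) rfl hK2 hΘ1 hc0 le_rfl le_rfl
    calc α ≤ P * Θk ^ (-(θ * κ)) + P * Θk ^ (-(θ * κ)) := add_le_add h1 h2
      _ = (P + P) * Θk ^ (-(θ * κ)) := by ring
      _ ≤ _ := mul_le_mul_of_nonneg_right h3 hDθ0
  -- the loss factors of `Γ`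
  have hrΘ : 1 + (ℓ₀ : ℝ) ≤ 6 * Θk := by linarith
  have hrΘ' : 1 + (((3 * ℓ₀ + 2 : ℕ) : ℝ)) ≤ 6 * Θk := by push_cast; linarith
  have hf1 : (cT ^ 2) ^ t ≤ 𝕂 ^ 1 * Θk ^ (((1 : ℕ) : ℝ) * 𝕔) :=
    c1_const_le h𝕔 hΘ1 (Real.rpow_nonneg (sq_nonneg _) _) (c1_cT_rpow_le hcT h𝕂 ht0 ht1).2
  have hf1' : cT ^ t ≤ 𝕂 ^ 1 * Θk ^ (((1 : ℕ) : ℝ) * 𝕔) :=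
    c1_const_le h𝕔 hΘ1 (Real.rpow_nonneg hcT.le _) (c1_cT_rpow_le hcT h𝕂 ht0 ht1).1
  have hf2 : ((boxIn S 0 ℓ₀).card : ℝ) ≤ 𝕂 ^ 1 * Θk ^ (((1 : ℕ) : ℝ) * 𝕔) :=
    c1_card_le h𝕂 h𝕔 hΘ1 hℓΘ ((c1_card_boxIn_le 0 _).trans (Nat.pow_le_pow_left (by omega) 4))
  have hf3 : ((boxOut S 0 ℓ₀).card : ℝ) ≤ 𝕂 ^ 1 * Θk ^ (((1 : ℕ) : ℝ) * 𝕔) :=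
    c1_card_le h𝕂 h𝕔 hΘ1 hℓΘ ((c1_card_boxOut_le 0 _).trans (Nat.pow_le_pow_left (by omega) 4))
  have hf4 : ((boxIn S 0 (3 * ℓ₀ + 2)).card : ℝ) ≤ 𝕂 ^ 1 * Θk ^ (((1 : ℕ) : ℝ) * 𝕔) :=
    c1_card_le h𝕂 h𝕔 hΘ1 hℓΘ ((c1_card_boxIn_le 0 _).trans (Nat.pow_le_pow_left (by omega) 4))
  have hf5 : ((boxOut S 0 (3 * ℓ₀ + 2)).card : ℝ) ≤ 𝕂 ^ 1 * Θk ^ (((1 : ℕ) : ℝ) * 𝕔) :=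
    c1_card_le h𝕂 h𝕔 hΘ1 hℓΘ ((c1_card_boxOut_le 0 _).trans (Nat.pow_le_pow_left (by omega) 4))
  have hf6 : C * (1 + |β|) ^ p * (1 + (ℓ₀ : ℝ)) ^ p ≤ 𝕂 ^ 1 * Θk ^ (((1 : ℕ) : ℝ) * 𝕔) :=
    c1_Xi_le hC h𝕂 h𝕔 hΘ1 hβΘ (Nat.cast_nonneg _) hrΘ
  have hf6' : C * (1 + |β|) ^ p * (1 + (((3 * ℓ₀ + 2 : ℕ) : ℝ))) ^ p ≤ 𝕂 ^ 1 * Θk ^ (((1 : ℕ) : ℝ) * 𝕔) :=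
    c1_Xi_le hC h𝕂 h𝕔 hΘ1 hβΘ (Nat.cast_nonneg _) hrΘ'
  have hf7 : Cf * (1 + |β|) ^ pf * (1 + (ℓ₀ : ℝ)) ^ pf ≤ 𝕂 ^ 1 * Θk ^ (((1 : ℕ) : ℝ) * 𝕔) :=
    c1_R_le hCf h𝕂 h𝕔 hΘ1 hβΘ (Nat.cast_nonneg _) hrΘ
  have hΞ0 : 0 ≤ C * (1 + |β|) ^ p * (1 + (ℓ₀ : ℝ)) ^ p :=
    mul_nonneg (mul_nonneg hC.le (Real.rpow_nonneg (by positivity) _)) (Real.rpow_nonneg (by positivity) _)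
  have hΞ0' : 0 ≤ C * (1 + |β|) ^ p * (1 + (((3 * ℓ₀ + 2 : ℕ) : ℝ))) ^ p :=
    mul_nonneg (mul_nonneg hC.le (Real.rpow_nonneg (by positivity) _)) (Real.rpow_nonneg (by positivity) _)
  have hR0 : 0 ≤ Cf * (1 + |β|) ^ pf * (1 + (ℓ₀ : ℝ)) ^ pf :=
    mul_nonneg (mul_nonneg hCf.le (Real.rpow_nonneg (by positivity) _)) (Real.rpow_nonneg (by positivity) _)
  -- non-negativity of the loss factors (no `positivity`: it would unfold the box finsets)
  have hc2t : 0 ≤ (cT ^ 2) ^ t := Real.rpow_nonneg (sq_nonneg _) _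
  have hX3 : 0 ≤ (cT ^ 2) ^ t * (boxIn S 0 ℓ₀).card * (boxOut S 0 ℓ₀).card * (boxIn S 0 (3 * ℓ₀ + 2)).card :=
    mul_nonneg (mul_nonneg (mul_nonneg hc2t (Nat.cast_nonneg _)) (Nat.cast_nonneg _)) (Nat.cast_nonneg _)
  have hK60 : 0 ≤ (cT ^ 2) ^ t * (boxIn S 0 ℓ₀).card * (boxOut S 0 ℓ₀).card * (boxIn S 0 (3 * ℓ₀ + 2)).card *
      (C * (1 + |β|) ^ p * (1 + (ℓ₀ : ℝ)) ^ p) * (Cf * (1 + |β|) ^ pf * (1 + (ℓ₀ : ℝ)) ^ pf) :=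
    mul_nonneg (mul_nonneg hX3 hΞ0) hR0
  have hJ1 : 0 ≤ cT ^ t * (C * (1 + |β|) ^ p * (1 + (((3 * ℓ₀ + 2 : ℕ) : ℝ))) ^ p) * (boxOut S 0 (3 * ℓ₀ + 2)).card *
      (boxOut S 0 (3 * ℓ₀ + 2)).card :=
    mul_nonneg (mul_nonneg (mul_nonneg (Real.rpow_nonneg hcT.le _) hΞ0') (Nat.cast_nonneg _)) (Nat.cast_nonneg _)
  -- `K₆ ≤ 𝕂⁶ Θ^{6𝕔}`
  have hK6 : (cT ^ 2) ^ t * (boxIn S 0 ℓ₀).card * (boxOut S 0 ℓ₀).card * (boxIn S 0 (3 * ℓ₀ + 2)).card *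
      (C * (1 + |β|) ^ p * (1 + (ℓ₀ : ℝ)) ^ p) * (Cf * (1 + |β|) ^ pf * (1 + (ℓ₀ : ℝ)) ^ pf) ≤
      𝕂 ^ 6 * Θk ^ (((6 : ℕ) : ℝ) * 𝕔) := by
    have g1 := c1_mono_mul (n := 2) rfl hΘ1 hc2t (Nat.cast_nonneg _) hf1 hf2
    have g2 := c1_mono_mul (n := 3) rfl hΘ1 (mul_nonneg hc2t (Nat.cast_nonneg _)) (Nat.cast_nonneg _) g1 hf3
    have g3 := c1_mono_mul (n := 4) rfl hΘ1 (mul_nonneg (mul_nonneg hc2t (Nat.cast_nonneg _)) (Nat.cast_nonneg _))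
      (Nat.cast_nonneg _) g2 hf4
    have g4 := c1_mono_mul (n := 5) rfl hΘ1 hX3 hΞ0 g3 hf6
    have g5 := c1_mono_mul (n := 6) rfl hΘ1 (mul_nonneg hX3 hΞ0) hR0 g4 hf7
    exact g5
  -- `J = 1 + c_T^t Ξ' |boxOut'|² ≤ 𝕂⁵ Θ^{5𝕔}`
  have hJ : 1 + cT ^ t * (C * (1 + |β|) ^ p * (1 + (((3 * ℓ₀ + 2 : ℕ) : ℝ))) ^ p) * (boxOut S 0 (3 * ℓ₀ + 2)).card *
      (boxOut S 0 (3 * ℓ₀ + 2)).card ≤ 𝕂 ^ 5 * Θk ^ (((5 : ℕ) : ℝ) * 𝕔) := by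
    have g1 := c1_mono_mul (n := 2) rfl hΘ1 (Real.rpow_nonneg hcT.le _) hΞ0' hf1' hf6'
    have g2 := c1_mono_mul (n := 3) rfl hΘ1 (mul_nonneg (Real.rpow_nonneg hcT.le _) hΞ0') (Nat.cast_nonneg _) g1 hf5
    have g3 := c1_mono_mul (n := 4) rfl hΘ1
      (mul_nonneg (mul_nonneg (Real.rpow_nonneg hcT.le _) hΞ0') (Nat.cast_nonneg _)) (Nat.cast_nonneg _) g2 hf5
    have g4 := c1_mono_one_add (n := 5) rfl hK2 hΘ1 hc0 g3
    exact g4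
  have hJ0 : 0 ≤ 1 + cT ^ t * (C * (1 + |β|) ^ p * (1 + (((3 * ℓ₀ + 2 : ℕ) : ℝ))) ^ p) *
      (boxOut S 0 (3 * ℓ₀ + 2)).card * (boxOut S 0 (3 * ℓ₀ + 2)).card := add_nonneg zero_le_one hJ1
  -- `Γ` and `b`
  set Γ : ℝ := (cT ^ 2) ^ t * (boxIn S 0 ℓ₀).card * (boxOut S 0 ℓ₀).card * (boxIn S 0 (3 * ℓ₀ + 2)).card *
    (C * (1 + |β|) ^ p * (1 + (ℓ₀ : ℝ)) ^ p) * (Cf * (1 + |β|) ^ pf * (1 + (ℓ₀ : ℝ)) ^ pf) * α *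
    (1 + cT ^ t * (C * (1 + |β|) ^ p * (1 + (((3 * ℓ₀ + 2 : ℕ) : ℝ))) ^ p) * (boxOut S 0 (3 * ℓ₀ + 2)).card *
      (boxOut S 0 (3 * ℓ₀ + 2)).card) with hΓ
  have hΓ0 : 0 ≤ Γ := by rw [hΓ]; exact mul_nonneg (mul_nonneg hK60 hα0) hJ0
  have hΓle : Γ ≤ 𝕂 ^ 21 * Θk ^ (((21 : ℕ) : ℝ) * 𝕔) * Θk ^ (-(θ * κ)) := by
    have g1 := c1_mono_mul (n := 11) rfl hΘ1 hK60 hJ0 hK6 hJ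
    have g0 : 0 ≤ 𝕂 ^ 11 * Θk ^ (((11 : ℕ) : ℝ) * 𝕔) := by positivity
    calc Γ = ((cT ^ 2) ^ t * (boxIn S 0 ℓ₀).card * (boxOut S 0 ℓ₀).card * (boxIn S 0 (3 * ℓ₀ + 2)).card *
          (C * (1 + |β|) ^ p * (1 + (ℓ₀ : ℝ)) ^ p) * (Cf * (1 + |β|) ^ pf * (1 + (ℓ₀ : ℝ)) ^ pf) *
          (1 + cT ^ t * (C * (1 + |β|) ^ p * (1 + (((3 * ℓ₀ + 2 : ℕ) : ℝ))) ^ p) * (boxOut S 0 (3 * ℓ₀ + 2)).card *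
            (boxOut S 0 (3 * ℓ₀ + 2)).card)) * α := by rw [hΓ]; ring
      _ ≤ (𝕂 ^ 11 * Θk ^ (((11 : ℕ) : ℝ) * 𝕔)) * (𝕂 ^ 10 * Θk ^ (((10 : ℕ) : ℝ) * 𝕔) * Θk ^ (-(θ * κ))) :=
          mul_le_mul g1 hαle hα0 g0
      _ = _ := by
          rw [show (21 : ℕ) = 11 + 10 from rfl, pow_add, Nat.cast_add, add_mul, Real.rpow_add hΘ0]
          ring
  set b : ℝ := Γ * ((boxIn S 0 (3 * ℓ₀ + 2)).card + (boxOut S 0 (3 * ℓ₀ + 2)).card) with hb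
  have hb0 : 0 ≤ b := by rw [hb]; exact mul_nonneg hΓ0 (add_nonneg (Nat.cast_nonneg _) (Nat.cast_nonneg _))
  have hcards : ((boxIn S 0 (3 * ℓ₀ + 2)).card : ℝ) + (boxOut S 0 (3 * ℓ₀ + 2)).card ≤
      𝕂 ^ 2 * Θk ^ (((2 : ℕ) : ℝ) * 𝕔) := c1_mono_add (n := 2) rfl hK2 hΘ1 hc0 hf4 hf5
  have hble : b ≤ 𝕂 ^ 23 * Θk ^ (((23 : ℕ) : ℝ) * 𝕔) * Θk ^ (-(θ * κ)) := by
    calc b ≤ (𝕂 ^ 21 * Θk ^ (((21 : ℕ) : ℝ) * 𝕔) * Θk ^ (-(θ * κ))) * (𝕂 ^ 2 * Θk ^ (((2 : ℕ) : ℝ) * 𝕔)) :=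
          mul_le_mul hΓle hcards (add_nonneg (Nat.cast_nonneg _) (Nat.cast_nonneg _)) (by positivity)
      _ = _ := by
          rw [show (23 : ℕ) = 21 + 2 from rfl, pow_add, Nat.cast_add, add_mul, Real.rpow_add hΘ0]
          ring
  have hb1 : b ≤ 1 := hble.trans hsmall
  -- the a-priori bound `M`
  have hM0 : 0 ≤ C * (1 + |β|) ^ p := mul_nonneg hC.le (Real.rpow_nonneg (by positivity) _)
  have hMle : C * (1 + |β|) ^ p ≤ 𝕂 ^ 1 * Θk ^ (((1 : ℕ) : ℝ) * 𝕔) := by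
    have := c1_Xi_le (r := 0) hC h𝕂 h𝕔 hΘ1 hβΘ le_rfl (by linarith)
    simpa only [add_zero, Real.one_rpow, mul_one] using this
  -- the iteration
  refine ⟨b, C * (1 + |β|) ^ p, hb0, hble, hM0, hMle, ?_⟩
  have hiter := SubharmonicIteration.le_mul_pow_div_of_sum_step (V := TorusSite 4 (2 * S + 1))
    (R := 3 * ℓ₀ + 3) Torus.tnorm
    (fun y => pqE Nf S β mq (fun U => blockNorm (wilsonD U (mq f))⁻¹ 0 y ^ t)) hM0 hb0 hb1
    (fun y => pqE_nonneg β mq _ fun U => Real.rpow_nonneg (blockNorm_nonneg _ _ _) _) (fun y => hT5 0 y)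
    (fun y => (boxIn S 0 (3 * ℓ₀ + 2) ∪ boxOut S 0 (3 * ℓ₀ + 2)).image fun z => y - z) (fun _ _ => Γ)
    (fun _ _ => hΓ0) ?_ ?_ ?_ (Torus.proj (2 * S + 1) v)
  · rw [c1_tnorm_proj_of_mem_box hv, show 3 * ℓ₀ + 3 + 1 = 3 * ℓ₀ + 4 by omega] at hiter
    exact hiter
  · -- total weight
    intro y _
    rw [Finset.sum_const, nsmul_eq_mul, hb, mul_comm]
    refine mul_le_mul_of_nonneg_left ?_ hΓ0
    exact_mod_cast (Finset.card_image_le.trans (Finset.card_union_le _ _))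
  · -- the neighbourhood is at most `R + 1` closer
    intro y z' hz'
    obtain ⟨z, hz, rfl⟩ := Finset.mem_image.1 hz'
    have h1 := c1_tnorm_le_tnorm_sub_add y z
    have h2 := c1_tnorm_le_of_mem_boxIn_union_boxOut hz
    omega
  · -- the step: one-step subharmonicity + translation invariance
    intro y hy
    have hyΛ : y ∉ ebox S 0 (3 * ℓ₀ + 2) := c1_not_mem_ebox_of_tnorm_lt h33 hy
    have hstep := c1_subharmonic_le ht0 ht1 hts hcT hC hCf hT0 hTinv hTdec hT1 hFar hR 0 hℓ1 hfit hα0 hA y hyΛ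
    rw [Finset.sum_image fun a _ b _ h => sub_right_injective h]
    refine hstep.trans (le_of_eq ?_)
    rw [Finset.mul_sum]
    exact Finset.sum_congr rfl fun z _ => by rw [c1_pqE_translate_torus]

end Volume

end Summit.QuantumFields.QCD.Theorems.VonMisesCirclesC1
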